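import Literature.MathematicalPhysics.QuantumFieldTheory.Balaban1983to89.T4CouplingAnalyticity
import Literature.MathematicalPhysics.QuantumFieldTheory.Balaban1983to89.T4HistoryLipschitzRecursion

/-!
# NE9DerivativeTransport — route P3 «FINITE DIFFERENCES, ONE HISTORY COORDINATE AT A TIME» for the spine estimate NE9
(node U3, cell `pub-balaban`, rung (B)+1 on a finite T⁴): the one-coordinate Lipschitz moduli of `E^{(j)}(X; g⃗, U)` are
SUPS OF ONE-COORDINATE DERIVATIVES `∂_{u_i}E^{(j)}`, these derivative sups are TRANSPORTED through the renormalization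
recursion by a LINEAR renewal inequality (chain rule along the old-action channel), and telescoping over the coordinates
(tree `T4CouplingAnalyticity.ne9_iff_coordLipschitzOn`) assembles `T4OutputRate.NE9 ∧ T4OutputRate.FadingMemory`
(BINDER row NE9 co-owner #3, unit `b2b-balaban-t4-ne9-p3`, ROUND-2 skeleton-first; skeleton of record
`HOME/t4/skeletons/NE9-t4-ne9-p3.md`)

HONEST FRAMING (T4-DAG PAGE 1).  The cell's T⁴ target is existence AND uniqueness of the `ε → 0` limit of gauge-invariant
observables of pure YM₄ on a FIXED finite torus, conditional on (B) and `FlowStep.BetaPertH` and on nine NEW spine estimates,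
none printed; NOT infinite volume, NOT the mass gap, NOT the Clay problem.  NE9 is NOT PRINTED ([Balaban1987RG1] p. 263 gives
only *"It is a C^∞-function of g_{j−1} ∈ [0, γ], (or analytic)"*, qualitatively and for the LAST coupling; cell GAPS
G-t4-U3-3).  This module is OUR OWN WORK (placement rule 2026-08-19: Summits side): GENERIC real analysis and bookkeeping over
the ABSTRACT carriers of `T4OutputRate`; it asserts NOTHING about Bałaban's constructed functionals (not objects of the tree),
does NOT discharge NE9, and leaves the spine count 0/9 unchanged.  (B), (B^μ), `BetaPertH` do not occur.  The manuscripts under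
audit ([I] = [Balaban1987RG1], [II] = [Balaban1988RG2Cluster]) are quoted for STRUCTURE only (ABSOLUTE RULE: no internally
minted statement enters as a cited fact; every analytic input of the route is a displayed binder).

THE ROUTE (what this module kernel-checks, §1–§4; the dictionary to print is in the skeleton).
* §1 `CoordDerivBound I E κ D` (binder): inside the box window over a coordinate set `I`, the map
  `s ↦ E (h[i := s]) U X` has, for every coordinate `i < scale X`, a derivative within `I` bounded by `D (scale X) i·e^{−κd(X)}`.
  By the MEAN VALUE THEOREM on the convex coordinate set this gives P1's coordinatewise shape `CoordLipschitzOn I E κ D`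
  (`coordLipschitzOn_of_derivBound`), hence `NE9 E (BoxWindow I) κ D` by P1's telescoping theorem `ne9_of_coordLipschitz`
  (hybrid histories, prefix dependence) — `ne9_of_derivBound`.  Print's adopted branch for the last coupling is exactly
  «C^∞» (p. 263); the derivative form needs no complex coupling.
* §2 `DerivTransport lam a D` (binder, pure arithmetic on the derivative profile): BIRTH `D (k+1) k ≤ lam k` (the new term's
  derivative in its OWN coupling) and TRANSPORT `D (k+1) i ≤ Σ_{m=i+1}^{k} a k m·D m i` for `i < k` (the new term reads the
  coordinate `i < k` ONLY through the old terms created at steps `m = i+1, …, k` — [I] (2.12) p. 268: the earlier couplings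
  enter the curly bracket `{𝐄_k(U_k(exp i[…]V^{(k)})) − 𝐄_k(U_k(V^{(k)}))}` only, which is LINEAR in the old action; CHAIN RULE).
  `profile_le_of_renewalSuper`: any profile obeying the transport inequalities lies below every super-solution of P2's
  renewal inequalities `T4HistoryLipschitzRecursion.RenewalSuper lam a` (strong induction) — so P2's product/geometric moduli
  `prodModuli ℓ (fun _ => ω + c)` bound the derivative profile under `lam ≤ ℓ`, `0 ≤ a k m ≤ c·ω^{k−m}`.
* §3 END `ne9_and_fadingMemory_of_derivTransport`: §1 + §2 ⇒ `NE9 E (BoxWindow I) κ (prodModuli ℓ fun _ => ω + c) ∧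
  FadingMemory (ℓ/(ω+c)) (ω+c) (prodModuli ℓ fun _ => ω + c)` — the SAME modulus family as the END faces of routes P1/P2
  (`T4HistoryLipschitzBridge.prodModuli_const_eq_geomMod`), so node U3/U2/U5 consumers are unchanged.
* §4 THE CAUCHY FACE, OSCILLATION FORM (`CoordHolomorphicOsc`, `coordLipschitzOn_of_holomorphicOsc`): a one-coordinate
  holomorphic extension on `r`-discs whose OSCILLATION (not sup) is `≤ η j i·e^{−κd}` gives `CoordLipschitzOn` with
  `Λ j i = 4·η j i / r j i` (tree `Dimock2015.real_param_lipschitz` applied to `F − F(s₀)`); P1's sup-form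
  `CouplingAnalyticOn I E κ M r` is the instance `η ≡ 2M` (`coordHolomorphicOsc_of_couplingAnalyticOn`).  This records the
  repair of P1's dead end «fading memory from GROWTH of the coordinate radii — dead, radii do not grow» (cell record
  `t4/T4-EST-NE9-P1.md` §3.2): at FIXED radius the Cauchy route sees fading memory through the DECAY OF OSCILLATIONS
  (= the transported derivative sizes of §2), not through the sup.
* §6 (v1.1, append-only) the FINITE-DIFFERENCE face `ne9_and_fadingMemory_of_lipTransport`: the same END with P1's
  `CoordLipschitzOn I E κ Λ₁` (a one-coordinate LIPSCHITZ profile) in place of the derivative binder — no convexity, no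
  differentiability; `coordLipschitzOn_mono`, `birth_of_ne9`.
* §5 toy witness on P2's `toyCarriers`/`toyE` (`E_{k+1} = g_k + μE_k`): `CoordDerivBound` holds with the EXACT derivative
  profile `μ^{j−1−i}` and `DerivTransport` with `lam ≡ 1`, `a k m = μ·[m = k]`; the END returns NE9 with `prodModuli 1 (fun _
  => μ)` — attained (`T4HistoryLipschitzRecursion.toyE_sub`): nothing is lost at the interface.

WHAT IS NOT HERE (the leaves of the skeleton, displayed there with loci): the derivative bound at BIRTH for Bałaban's step
(own coupling: in the unscaled variables B′ of [I] (2.10) p. 267 every g_k-dependence is the prefactor `1/g_k²` and the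
cut-off (2.9) is g_k-free, so `∂_{t_k}` is an INSERTION of the fluctuation action density at REAL coupling; equivalently
Cauchy on the t-dilation sector, tree `T4ComplexDilation`); the TRANSPORT coefficients for Bałaban's step (outer derivative
of (2.13) in the potentials × per-creation-step channel weights of [II] Lemma 1 (1.33)–(1.36) with the pre-summation factor
p. 8 *"This yields (6L)⁴L^jη"* — route P2's `OuterLipschitz`/`ChannelSizeAtStepNN` readings BY NAME); the rate
`ω + c < 1` (NOT PRINTED, cell GAPS G-ne9p2-3).  NOT summit progress.

References (STRUCTURE only): T. Bałaban, CMP **109** (1987) 249–301 [Balaban1987RG1]: (0.23) p. 256, §1 p. 263, (2.9)–(2.14)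
pp. 266–268; T. Bałaban, CMP **116** (1988) 1–22 [Balaban1988RG2Cluster]: Lemma 1 (1.33)–(1.36) p. 9, p. 8 l. 9–10;
J. Dimock, C. Yuan, arXiv:2303.07916 [DimockYuan2024GNFlow] proof of Thm 4 (Cauchy ⇒ Lipschitz, tree `Dimock2015.AnalyticLipschitz`).
-/

noncomputable section

namespace Summit.QuantumFields.BalabanUV.T4Continuum.NE9DerivativeTransport

open Set Metric
open Literature.MathematicalPhysics.QuantumFieldTheory.Balaban1983to89
open Literature.MathematicalPhysics.QuantumFieldTheory.Balaban1983to89.T4OutputRate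
open Literature.MathematicalPhysics.QuantumFieldTheory.Balaban1983to89.T4CouplingAnalyticity
open Literature.MathematicalPhysics.QuantumFieldTheory.Balaban1983to89.T4HistoryLipschitzRecursion
open Literature.MathematicalPhysics.QuantumFieldTheory (Dimock2015.real_param_lipschitz)

variable {C : Carriers}

/-! ## §1 One-coordinate derivative bounds ⇒ coordinatewise Lipschitz ⇒ NE9 -/

/-- HYPOTHESIS SHAPE (NOT PRINTED for Bałaban's `E^{(j)}`; print's adopted branch made quantitative): ONE-COORDINATE
DERIVATIVE BOUNDS.  For every background `U`, domain `X` (`j = scale X`), box history `h` over the coordinate set `I` and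
coordinate `i < j`, the real function `s ↦ E (h[i := s]) U X` has a derivative within `I` at every point of `I`, bounded by
`D j i · e^{−κd(X)}`.  Print: [Balaban1987RG1] p. 263 *"It is a C^∞-function of g_{j−1} ∈ [0, γ], (or analytic), with a
positive, absolute γ."* — the LAST coupling, no bound; p. 256 *"The function 𝐄_k depends also on the effective coupling
constants g_0, …, g_{k−1}."* — nothing quantitative.  Nothing asserted. [cite: Balaban1987RG1, §1 p.263 and §0 p.256] -/
def CoordDerivBound {Bg : Type} (I : Set ℝ) (E : Functional C Bg) (κ : ℝ) (D : ℕ → ℕ → ℝ) : Prop :=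
  ∀ (U : Bg) (X : C.Dom), ∀ h ∈ BoxWindow I, ∀ i < C.scale X,
    ∃ f' : ℝ → ℝ,
      (∀ s ∈ I, HasDerivWithinAt (fun s => E (Function.update h i s) U X) (f' s) I s) ∧
        ∀ s ∈ I, |f' s| ≤ D (C.scale X) i * Real.exp (-(κ * C.d X))

/-- Monotonicity of the derivative-bound shape in the profile (only the entries `i < j` matter). [folklore] -/
theorem coordDerivBound_mono {Bg : Type} {I : Set ℝ} {E : Functional C Bg} {κ : ℝ} {D D' : ℕ → ℕ → ℝ}
    (hDD : ∀ j i, i < j → D j i ≤ D' j i) (hD : CoordDerivBound I E κ D) : CoordDerivBound I E κ D' := by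
  intro U X h hh i hi
  obtain ⟨f', hf', hb⟩ := hD U X h hh i hi
  refine ⟨f', hf', fun s hs => (hb s hs).trans ?_⟩
  exact mul_le_mul_of_nonneg_right (hDD _ _ hi) (Real.exp_pos _).le

/-- **MEAN VALUE THEOREM, coordinatewise**: on a CONVEX coordinate set, one-coordinate derivative bounds give P1's
coordinatewise Lipschitz shape `CoordLipschitzOn I E κ D` with the SAME constants (Mathlib
`Convex.norm_image_sub_le_of_norm_hasDerivWithin_le`). [folklore] -/
theorem coordLipschitzOn_of_derivBound {Bg : Type} {I : Set ℝ} {E : Functional C Bg} {κ : ℝ} {D : ℕ → ℕ → ℝ}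
    (hI : Convex ℝ I) (hD : CoordDerivBound I E κ D) : CoordLipschitzOn I E κ D := by
  intro U X h hh i hi s hs s' hs'
  obtain ⟨f', hf', hb⟩ := hD U X h hh i hi
  have hb' : ∀ x ∈ I, ‖f' x‖ ≤ D (C.scale X) i * Real.exp (-(κ * C.d X)) := fun x hx => by
    rw [Real.norm_eq_abs]; exact hb x hx
  have key := hI.norm_image_sub_le_of_norm_hasDerivWithin_le hf' hb' hs' hs
  rw [Real.norm_eq_abs, Real.norm_eq_abs] at key
  calc |E (Function.update h i s) U X - E (Function.update h i s') U X|
      ≤ D (C.scale X) i * Real.exp (-(κ * C.d X)) * |s - s'| := key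
    _ = Real.exp (-(κ * C.d X)) * (D (C.scale X) i * |s - s'|) := by ring

/-- **NE9 FROM ONE-COORDINATE DERIVATIVE BOUNDS** (the finite-difference route's assembly, memory profile as given):
prefix dependence + derivative bounds over a convex coordinate set ⇒ `T4OutputRate.NE9 E (BoxWindow I) κ D` — P1's
telescoping through hybrid histories (`T4CouplingAnalyticity.ne9_of_coordLipschitz`) after §1's mean value step. [folklore] -/
theorem ne9_of_derivBound {Bg : Type} {I : Set ℝ} {E : Functional C Bg} {κ : ℝ} {D : ℕ → ℕ → ℝ}
    (hI : Convex ℝ I) (hP : PrefixDependenceOn E (BoxWindow I)) (hD : CoordDerivBound I E κ D) :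
    NE9 E (BoxWindow I) κ D :=
  ne9_of_coordLipschitz hP (coordLipschitzOn_of_derivBound hI hD)

/-! ## §2 Transport of the derivative profile through the recursion (pure arithmetic) -/

/-- HYPOTHESIS SHAPE (arithmetic on a profile; its two lines are the route's analytic leaves once instantiated): DERIVATIVE
TRANSPORT.  BIRTH: the derivative of the term created at step `k + 1` in its OWN coupling `g_k` is at most `lam k`.
TRANSPORT: for an OLDER coordinate `i < k` the derivative of the term created at step `k + 1` is at most
`Σ_{m=i+1}^{k} a k m · D m i` — the coordinate `i` is read only through the terms created at the steps `m = i+1, …, k`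
([Balaban1987RG1] (2.12)–(2.13) p. 268: the earlier couplings enter the new term only through the old action inside the curly
bracket, LINEARLY), `a k m` = (outer derivative of the new term in the step-m slot of the channel) × (channel weight of
creation step m).  No constant of either kind is printed. [cite: Balaban1987RG1, (2.12)-(2.13) p.268] -/
def DerivTransport (lam : ℕ → ℝ) (a : ℕ → ℕ → ℝ) (D : ℕ → ℕ → ℝ) : Prop :=
  (∀ k, D (k + 1) k ≤ lam k) ∧
    ∀ k i, i < k → D (k + 1) i ≤ ∑ m ∈ Finset.Ico (i + 1) (k + 1), a k m * D m i

/-- **A transported profile lies below every renewal super-solution**: if `D` obeys the transport inequalities for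
`(lam, a)` with `a ≥ 0`, and `Λ` satisfies P2's renewal inequalities `RenewalSuper lam a Λ`, then `D j i ≤ Λ j i` for all
`i < j`.  Strong induction on the creation step `j`. [folklore] -/
theorem profile_le_of_renewalSuper {lam : ℕ → ℝ} {a D Λ : ℕ → ℕ → ℝ} (hT : DerivTransport lam a D)
    (ha : ∀ k m, m ≤ k → 0 ≤ a k m) (hΛ : RenewalSuper lam a Λ) : ∀ j i, i < j → D j i ≤ Λ j i := by
  intro j
  induction j using Nat.strong_induction_on with
  | _ j ih =>
    intro i hij
    obtain ⟨k, rfl⟩ : ∃ k, j = k + 1 := ⟨j - 1, by omega⟩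
    rcases Nat.lt_or_ge i k with hik | hki
    · calc D (k + 1) i ≤ ∑ m ∈ Finset.Ico (i + 1) (k + 1), a k m * D m i := hT.2 k i hik
        _ ≤ ∑ m ∈ Finset.Ico (i + 1) (k + 1), a k m * Λ m i := by
            refine Finset.sum_le_sum fun m hm => ?_
            rw [Finset.mem_Ico] at hm
            exact mul_le_mul_of_nonneg_left (ih m hm.2 i (by omega)) (ha k m (by omega))
        _ ≤ Λ (k + 1) i := hΛ.2 k i hik
    · have hi : i = k := by omega
      subst hi
      exact (hT.1 i).trans (hΛ.1 i)

/-- The transported profile under GEOMETRIC transfer coefficients: `lam k ≤ ℓ`, `0 ≤ a k m ≤ c·ω^{k−m}` (`ℓ, c, ω ≥ 0`) ⇒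
`D j i ≤ prodModuli ℓ (fun _ => ω + c) j i = ℓ(ω + c)^{j−1−i}` for `i < j` (P2's `renewalSuper_geometric` + the comparison
above). [folklore] -/
theorem profile_le_prodModuli {lam : ℕ → ℝ} {a D : ℕ → ℕ → ℝ} {ℓ c ω : ℝ} (hT : DerivTransport lam a D)
    (hℓ : 0 ≤ ℓ) (hc : 0 ≤ c) (hω : 0 ≤ ω) (hlam : ∀ k, lam k ≤ ℓ) (ha0 : ∀ k m, m ≤ k → 0 ≤ a k m)
    (ha : ∀ k m, m ≤ k → a k m ≤ c * ω ^ (k - m)) :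
    ∀ j i, i < j → D j i ≤ prodModuli ℓ (fun _ => ω + c) j i :=
  profile_le_of_renewalSuper hT ha0 (renewalSuper_geometric hℓ hc hω hlam ha)

/-! ## §3 The composed statement -/

/-- **END (route P3).**  Over a convex coordinate set `I`: prefix dependence (printed in words, [Balaban1987RG1] p. 256) +
one-coordinate derivative bounds with profile `D` + derivative transport with birth constants `lam ≤ ℓ` and geometric
transfer coefficients `0 ≤ a k m ≤ c·ω^{k−m}` ⇒
`NE9 E (BoxWindow I) κ (prodModuli ℓ fun _ => ω + c) ∧ FadingMemory (ℓ/(ω + c)) (ω + c) (prodModuli ℓ fun _ => ω + c)`.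
The memory FADES for the consumers (`T4OutputRate.historySum_le_of_fadingMemory`) iff `ω + c < 1` — NOT PRINTED (cell GAPS
G-ne9p2-3); the END itself only needs `0 < ω + c`. [folklore] -/
theorem ne9_and_fadingMemory_of_derivTransport {Bg : Type} {I : Set ℝ} {E : Functional C Bg} {κ : ℝ}
    {D : ℕ → ℕ → ℝ} {lam : ℕ → ℝ} {a : ℕ → ℕ → ℝ} {ℓ c ω : ℝ}
    (hI : Convex ℝ I) (hP : PrefixDependenceOn E (BoxWindow I)) (hD : CoordDerivBound I E κ D)
    (hT : DerivTransport lam a D) (hℓ : 0 ≤ ℓ) (hc : 0 ≤ c) (hω : 0 ≤ ω) (hpos : 0 < ω + c)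
    (hlam : ∀ k, lam k ≤ ℓ) (ha0 : ∀ k m, m ≤ k → 0 ≤ a k m) (ha : ∀ k m, m ≤ k → a k m ≤ c * ω ^ (k - m)) :
    NE9 E (BoxWindow I) κ (prodModuli ℓ fun _ => ω + c) ∧
      FadingMemory (ℓ / (ω + c)) (ω + c) (prodModuli ℓ fun _ => ω + c) :=
  ⟨ne9_of_derivBound hI hP (coordDerivBound_mono (profile_le_prodModuli hT hℓ hc hω hlam ha0 ha) hD),
    fadingMemory_geometric hℓ hpos⟩

/-- The END on the printed coupling window `]0, γ]^ℕ = T4OutputRate.Window γ` (g-currency; `Window γ = BoxWindow (Ioc 0 γ)`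
definitionally, `T4CouplingAnalyticity.window_eq_boxWindow`).  For relative-radius inputs use a logarithmic currency instead
(P1's `ne9Log_of_couplingAnalyticRel` pattern): the shape is currency-agnostic. [folklore] -/
theorem ne9_and_fadingMemory_of_derivTransport_window {Bg : Type} {γ : ℝ} {E : Functional C Bg} {κ : ℝ}
    {D : ℕ → ℕ → ℝ} {lam : ℕ → ℝ} {a : ℕ → ℕ → ℝ} {ℓ c ω : ℝ}
    (hP : PrefixDependenceOn E (Window γ)) (hD : CoordDerivBound (Set.Ioc 0 γ) E κ D)
    (hT : DerivTransport lam a D) (hℓ : 0 ≤ ℓ) (hc : 0 ≤ c) (hω : 0 ≤ ω) (hpos : 0 < ω + c)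
    (hlam : ∀ k, lam k ≤ ℓ) (ha0 : ∀ k m, m ≤ k → 0 ≤ a k m) (ha : ∀ k m, m ≤ k → a k m ≤ c * ω ^ (k - m)) :
    NE9 E (Window γ) κ (prodModuli ℓ fun _ => ω + c) ∧
      FadingMemory (ℓ / (ω + c)) (ω + c) (prodModuli ℓ fun _ => ω + c) :=
  ne9_and_fadingMemory_of_derivTransport (convex_Ioc 0 γ) hP hD hT hℓ hc hω hpos hlam ha0 ha

/-! ## §4 The Cauchy face in OSCILLATION form (fixed radius, decaying oscillation) -/

/-- HYPOTHESIS SHAPE (NOT PRINTED): ONE-COORDINATE HOLOMORPHIC EXTENSION WITH AN OSCILLATION PROFILE.  As P1's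
`CouplingAnalyticOn I E κ M r`, except that what is bounded on the extension domain is the OSCILLATION
`‖F z − F w‖ ≤ η j i·e^{−κd(X)}` rather than the size.  Print: [Balaban1987RG1] p. 266 *"It has the advantage that the
functions E^{(j)}, β_j are analytic functions of the effective coupling constants"* (alternative cut-off; no radius, no
bound). Nothing asserted. [cite: Balaban1987RG1, §2 p.266] -/
def CoordHolomorphicOsc {Bg : Type} (I : Set ℝ) (E : Functional C Bg) (κ : ℝ) (η r : ℕ → ℕ → ℝ) : Prop :=
  ∀ (U : Bg) (X : C.Dom), ∀ h ∈ BoxWindow I, ∀ i < C.scale X,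
    ∃ (F : ℂ → ℂ) (Dset : Set ℂ), DifferentiableOn ℂ F Dset ∧
      (∀ z ∈ Dset, ∀ w ∈ Dset, ‖F z - F w‖ ≤ η (C.scale X) i * Real.exp (-(κ * C.d X))) ∧
      (∀ s ∈ I, closedBall (s : ℂ) (r (C.scale X) i) ⊆ Dset) ∧
      (∀ s ∈ I, F s = (E (Function.update h i s) U X : ℂ))

/-- **Oscillation-form Cauchy ⇒ coordinatewise Lipschitz with `Λ j i = 4·η j i / r j i`** (tree
`Dimock2015.real_param_lipschitz` applied to `F − F(s₀)`, whose size on the extension domain is the oscillation).  At FIXED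
radius the modulus is proportional to the OSCILLATION of the scale-j term in the coordinate `i` — the quantity that decays in
`j − i` (§2), whereas the sup does not. [cite: DimockYuan2024GNFlow, proof of Thm 4 (arXiv:2303.07916v3 TeX ll. 4073–4076)] -/
theorem coordLipschitzOn_of_holomorphicOsc {Bg : Type} {I : Set ℝ} {E : Functional C Bg} {κ : ℝ} {η r : ℕ → ℕ → ℝ}
    (hI : I.OrdConnected) (hr : ∀ j i, i < j → 0 < r j i) (hA : CoordHolomorphicOsc I E κ η r) :
    CoordLipschitzOn I E κ (fun j i => 4 * η j i / r j i) := by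
  intro U X h hh i hi s hs s' hs'
  obtain ⟨F, Dset, hF, hosc, hdisc, hval⟩ := hA U X h hh i hi
  -- the shifted function `G := F − F(s)` has size ≤ osc on `Dset`
  set G : ℂ → ℂ := fun z => F z - F (s : ℂ) with hG
  have hGd : DifferentiableOn ℂ G Dset := hF.sub (differentiableOn_const _)
  have hsD : (s : ℂ) ∈ Dset := hdisc s hs (mem_closedBall_self (hr _ _ hi).le)
  have hGM : ∀ z ∈ Dset, ‖G z‖ ≤ η (C.scale X) i * Real.exp (-(κ * C.d X)) := fun z hz => hosc z hz _ hsD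
  -- the real segment between `s` and `s'` lies in `I`
  have hseg : ∀ t ∈ Icc (min s s') (max s s'), closedBall (t : ℂ) (r (C.scale X) i) ⊆ Dset := by
    intro t ht
    refine hdisc t ?_
    rcases le_total s s' with hle | hle
    · rw [min_eq_left hle, max_eq_right hle] at ht
      exact hI.out hs hs' ht
    · rw [min_eq_right hle, max_eq_left hle] at ht
      exact hI.out hs' hs ht
  have hsI : s ∈ Icc (min s s') (max s s') := ⟨min_le_left _ _, le_max_left _ _⟩
  have hs'I : s' ∈ Icc (min s s') (max s s') := ⟨min_le_right _ _, le_max_right _ _⟩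
  have key := Dimock2015.real_param_lipschitz (hr _ _ hi) hGd hGM hseg hsI hs'I
  -- `G s − G s' = F s − F s'` and the values are the real numbers `E (h[i:=·]) U X`
  have hGs : G (s : ℂ) - G (s' : ℂ) = F s - F s' := by simp only [hG]; ring
  rw [hGs, hval s hs, hval s' hs', ← Complex.ofReal_sub, Complex.norm_real, Real.norm_eq_abs] at key
  calc |E (Function.update h i s) U X - E (Function.update h i s') U X|
      ≤ 4 * (η (C.scale X) i * Real.exp (-(κ * C.d X))) / r (C.scale X) i * |s - s'| := key
    _ = Real.exp (-(κ * C.d X)) * (4 * η (C.scale X) i / r (C.scale X) i * |s - s'|) := by ring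

/-- P1's SUP form is the instance `η ≡ 2M` of the oscillation form (oscillation ≤ twice the size) — so
`T4CouplingAnalyticity.ne9_of_couplingAnalyticOn` (moduli `4M/r`, NON-fading) is the memoryless corner of this face, and any
decay of `η j i` in `j − i` is read off directly as decay of the moduli. [folklore] -/
theorem coordHolomorphicOsc_of_couplingAnalyticOn {Bg : Type} {I : Set ℝ} {E : Functional C Bg} {κ M : ℝ}
    {r : ℕ → ℕ → ℝ} (hA : CouplingAnalyticOn I E κ M r) :
    CoordHolomorphicOsc I E κ (fun _ _ => 2 * M) r := by
  intro U X h hh i hi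
  obtain ⟨F, Dset, hF, hM, hdisc, hval⟩ := hA U X h hh i hi
  refine ⟨F, Dset, hF, fun z hz w hw => ?_, hdisc, hval⟩
  calc ‖F z - F w‖ ≤ ‖F z‖ + ‖F w‖ := norm_sub_le _ _
    _ ≤ M * Real.exp (-(κ * C.d X)) + M * Real.exp (-(κ * C.d X)) := add_le_add (hM z hz) (hM w hw)
    _ = 2 * M * Real.exp (-(κ * C.d X)) := by ring

/-- NE9 from the oscillation face (memory profile `4η/r` as given; telescoping as in §1). [folklore] -/
theorem ne9_of_holomorphicOsc {Bg : Type} {I : Set ℝ} {E : Functional C Bg} {κ : ℝ} {η r : ℕ → ℕ → ℝ}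
    (hI : I.OrdConnected) (hr : ∀ j i, i < j → 0 < r j i) (hP : PrefixDependenceOn E (BoxWindow I))
    (hA : CoordHolomorphicOsc I E κ η r) : NE9 E (BoxWindow I) κ (fun j i => 4 * η j i / r j i) :=
  ne9_of_coordLipschitz hP (coordLipschitzOn_of_holomorphicOsc hI hr hA)

/-! ## §5 Toy witness: the recursion `E_{k+1} = g_k + μE_k` (P2's `toyE`) — derivative profile attained -/

/-- Updating the coordinate `i < k` of a history moves P2's toy term at scale `k` affinely with slope `μ^{k−1−i}`. [folklore] -/
theorem toyE_update (μ : ℝ) (h : ℕ → ℝ) (u : Unit) {k i : ℕ} (hi : i < k) (s : ℝ) :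
    toyE μ (Function.update h i s) u k = toyE μ h u k + μ ^ (k - 1 - i) * (s - h i) := by
  simp only [toyE]
  have hsplit : ∀ (g : ℕ → ℝ), ∑ x ∈ Finset.range k, μ ^ (k - 1 - x) * g x =
      μ ^ (k - 1 - i) * g i + ∑ x ∈ (Finset.range k).erase i, μ ^ (k - 1 - x) * g x := fun g =>
    (Finset.add_sum_erase _ _ (Finset.mem_range.2 hi)).symm
  rw [hsplit, hsplit h, Function.update_self]
  have hrest : ∑ x ∈ (Finset.range k).erase i, μ ^ (k - 1 - x) * Function.update h i s x =
      ∑ x ∈ (Finset.range k).erase i, μ ^ (k - 1 - x) * h x :=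
    Finset.sum_congr rfl fun x hx => by rw [Function.update_of_ne (Finset.ne_of_mem_erase hx)]
  rw [hrest]
  ring

/-- The toy term has the EXACT one-coordinate derivative `μ^{k−1−i}` (any coordinate set, κ = 0). [folklore] -/
theorem toy_coordDerivBound (μ : ℝ) (I : Set ℝ) :
    CoordDerivBound (C := toyCarriers) I (toyE μ) 0 (fun k i => |μ| ^ (k - 1 - i)) := by
  intro u X h _ i hi
  change i < X at hi
  refine ⟨fun _ => μ ^ (X - 1 - i), fun s _ => ?_, fun s _ => ?_⟩
  · have hfun : (fun s => toyE μ (Function.update h i s) u X) =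
        fun s => toyE μ h u X + μ ^ (X - 1 - i) * (s - h i) := funext fun s => toyE_update μ h u hi s
    rw [hfun]
    have hd : HasDerivAt (fun s : ℝ => toyE μ h u X + μ ^ (X - 1 - i) * (s - h i)) (μ ^ (X - 1 - i)) s := by
      have h1 := ((hasDerivAt_id s).sub_const (h i)).const_mul (μ ^ (X - 1 - i))
      simpa using h1.const_add (toyE μ h u X)
    exact hd.hasDerivWithinAt
  · simp [abs_pow]

/-- The toy derivative profile obeys the transport inequalities with birth constant `1` and transfer coefficients
`a k m = |μ|·[m = k]` (only the newest old term is read). [folklore] -/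
theorem toy_derivTransport (μ : ℝ) :
    DerivTransport (fun _ => 1) (fun k m => if m = k then |μ| else 0) (fun k i => |μ| ^ (k - 1 - i)) := by
  refine ⟨fun k => by simp, fun k i hik => ?_⟩
  have hmem : k ∈ Finset.Ico (i + 1) (k + 1) := Finset.mem_Ico.2 ⟨by omega, by omega⟩
  simp_rw [ite_mul, zero_mul, Finset.sum_ite_eq', if_pos hmem]
  have e : k + 1 - 1 - i = (k - 1 - i) + 1 := by omega
  rw [e, pow_succ, mul_comm]

/-- NON-VACUITY AND SHARPNESS of §3 on the toy: the END returns `NE9` with moduli `prodModuli 1 (fun _ => |μ|)` — for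
`μ > 0` these are `μ^{k−1−i}`, the TRUE coefficients of `toyE_sub` — and `FadingMemory (1/|μ|) |μ|`. [folklore] -/
theorem toy_ne9_of_derivTransport {μ : ℝ} (hμ : μ ≠ 0) (I : Set ℝ) (hI : Convex ℝ I) :
    NE9 (C := toyCarriers) (toyE μ) (BoxWindow I) 0 (prodModuli 1 fun _ => 0 + |μ|) ∧
      FadingMemory (1 / (0 + |μ|)) (0 + |μ|) (prodModuli 1 fun _ => 0 + |μ|) := by
  refine ne9_and_fadingMemory_of_derivTransport (lam := fun _ => 1) (a := fun k m => if m = k then |μ| else 0)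
    hI ?_ (toy_coordDerivBound μ I) (toy_derivTransport μ) zero_le_one (abs_nonneg μ) le_rfl
    (by simpa using hμ) (fun _ => le_rfl) (fun k m _ => ?_) (fun k m _ => ?_)
  · -- prefix dependence of the toy term: it reads only the coordinates below the scale
    intro g _ g' _ u X hagree
    simp only [toyE]
    exact Finset.sum_congr rfl fun i hi => by rw [hagree i (Finset.mem_range.1 hi)]
  · split_ifs <;> simp [abs_nonneg]
  · split_ifs with h
    · subst h; simp
    · positivity

/-! ## §6 (v1.1) The finite-difference face: transported one-coordinate LIPSCHITZ profiles (no derivative, no convexity)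

The END of §3 with the derivative binder `CoordDerivBound` replaced by P1's coordinatewise Lipschitz shape `CoordLipschitzOn`
itself: a one-coordinate modulus profile `Λ₁` obeying the SAME two transport lines (birth `Λ₁ (k+1) k ≤ lam k`, transport
`Λ₁ (k+1) i ≤ Σ_{m=i+1}^{k} a k m·Λ₁ m i`) is dominated by the geometric family, and telescoping gives NE9 ∧ FadingMemory.
This is the face a supplier of a LIPSCHITZ constant at birth feeds (e.g. the row owner's activity-level last-coupling
two-point bound `Support/NE9LastCouplingBridge`), with no differentiability asked anywhere. -/

/-- Monotonicity of P1's coordinatewise Lipschitz shape in the modulus profile (entries `i < j`). [folklore] -/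
theorem coordLipschitzOn_mono {Bg : Type} {I : Set ℝ} {E : Functional C Bg} {κ : ℝ} {Λ Λ' : ℕ → ℕ → ℝ}
    (hΛΛ : ∀ j i, i < j → Λ j i ≤ Λ' j i) (hL : CoordLipschitzOn I E κ Λ) : CoordLipschitzOn I E κ Λ' := by
  intro U X h hh i hi s hs s' hs'
  refine (hL U X h hh i hi s hs s' hs').trans ?_
  exact mul_le_mul_of_nonneg_left (mul_le_mul_of_nonneg_right (hΛΛ _ _ hi) (abs_nonneg _)) (Real.exp_pos _).le

/-- **END, FINITE-DIFFERENCE FACE.**  Prefix dependence + a one-coordinate Lipschitz profile `Λ₁` (`CoordLipschitzOn I E κ Λ₁`)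
obeying the transport inequalities `DerivTransport lam a Λ₁` with `lam ≤ ℓ`, `0 ≤ a k m ≤ c·ω^{k−m}` ⇒
`NE9 E (BoxWindow I) κ (prodModuli ℓ fun _ => ω + c) ∧ FadingMemory (ℓ/(ω + c)) (ω + c) (prodModuli ℓ fun _ => ω + c)` —
ANY coordinate set `I` (no convexity: the mean value step is not used). [folklore] -/
theorem ne9_and_fadingMemory_of_lipTransport {Bg : Type} {I : Set ℝ} {E : Functional C Bg} {κ : ℝ}
    {Λ₁ : ℕ → ℕ → ℝ} {lam : ℕ → ℝ} {a : ℕ → ℕ → ℝ} {ℓ c ω : ℝ}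
    (hP : PrefixDependenceOn E (BoxWindow I)) (hL : CoordLipschitzOn I E κ Λ₁)
    (hT : DerivTransport lam a Λ₁) (hℓ : 0 ≤ ℓ) (hc : 0 ≤ c) (hω : 0 ≤ ω) (hpos : 0 < ω + c)
    (hlam : ∀ k, lam k ≤ ℓ) (ha0 : ∀ k m, m ≤ k → 0 ≤ a k m) (ha : ∀ k m, m ≤ k → a k m ≤ c * ω ^ (k - m)) :
    NE9 E (BoxWindow I) κ (prodModuli ℓ fun _ => ω + c) ∧
      FadingMemory (ℓ / (ω + c)) (ω + c) (prodModuli ℓ fun _ => ω + c) :=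
  ⟨ne9_of_coordLipschitz hP (coordLipschitzOn_mono (profile_le_prodModuli hT hℓ hc hω hlam ha0 ha) hL),
    fadingMemory_geometric hℓ hpos⟩

/-- DEPTH-0 EXTRACTION (the converse bookkeeping, for suppliers): NE9 with moduli `Λ` on a box gives back the one-coordinate
Lipschitz profile `Λ` (P1's `coordLipschitzOn_of_ne9`), in particular the birth line with `lam k := Λ (k+1) k` — so a birth
constant can be READ OFF any NE9 statement and a transport profile any family dominating `Λ`. [folklore] -/
theorem birth_of_ne9 {Bg : Type} {I : Set ℝ} {E : Functional C Bg} {κ : ℝ} {Λ : ℕ → ℕ → ℝ}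
    (hNE : NE9 E (BoxWindow I) κ Λ) (U : Bg) (X : C.Dom) {h : ℕ → ℝ} (hh : h ∈ BoxWindow I) {k : ℕ}
    (hk : C.scale X = k + 1) {s s' : ℝ} (hs : s ∈ I) (hs' : s' ∈ I) :
    |E (Function.update h k s) U X - E (Function.update h k s') U X| ≤
      Real.exp (-(κ * C.d X)) * (Λ (k + 1) k * |s - s'|) := by
  have hkk : k < C.scale X := by omega
  have key := coordLipschitzOn_of_ne9 hNE U X h hh k hkk s hs s' hs'
  rwa [hk] at key

end Summit.QuantumFields.BalabanUV.T4Continuum.NE9DerivativeTransport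

end
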